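/-
Copyright (c) 2026 the pub-hodgecm-mathlib formalisation cell (harness21).  Prover seat hodgecm-mathlib-A-p12 (g24), 2026-09-02.  «S3-ram» seeding wave (LEAD F0P3a-plan (g12∕g13);
owner F0P3a-p06 (g15); (Cnt2′) chair F0P3a-p07 (g14)): organ (B-ii) «SHELL CLASS LAW» of the (α₂) TYPE-(2) line, file 2b «THE CLASS LAW» (design memo
`F0/P3a/A-p12/g24/DESIGN-Bii-ShellClassLaw.A-p12g24.md`; ⊇ ★ p847601 file 1, ★ p847640 file 2a).  Kernel lane, `--supports stmt-HodgeConjecture-24833`.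
-/
import Literature.NumberTheory.Rogawski1990.DepthZeroKappaTransferTypeTwoRamifiedShellFlipResidue   -- ★ p847640 (this seat) file 2a: the flip with prescribed residue, the unitary correction `k₀`
import Literature.NumberTheory.Rogawski1990.DepthZeroKappaTransferTypeTwoRamifiedDepthBalls         -- ★ p847555 (this seat) file II: the `cmDatum` currency of the depth-refined balls (⊇ ★ FILE C, `LocalEndoscopicChartDatumCM`)
import HarnessLib

/-!
# The shell class law of a type-(2) torus at a tame-ramified place: on every `GL₂(𝒪_w)`-stable family of `γ₂`-fixed `K⁰`-cosets the residual class of the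
# hermitian monodromy form takes each unit class constant equally often (Labesse–Langlands 1979 §2; Rogawski 1990 §4.9; Jacobowitz 1962 §7–§8)

Topic `NumberTheory/Rogawski1990`; namespace `Literature.NumberTheory.Automorphic.UnitaryGroup`.  THEOREMS ONLY (no definition, no instance, no notation, no named fact,
no `sorry`); kernel lane `--supports stmt-HodgeConjecture-24833`.  Cell `pub/hodgecm-mathlib` (D-0151), crux H413; «S3-ram» (count-neutral); seat A-p12 (g24).  HONEST LABEL:
HC_CM is proved only modulo the cell's 2 remaining named inputs (hLiu418 24832, h413 24833) until rung 0 closes; nothing printed is asserted here.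

THE MATHEMATICS (organ (B-ii) «SHELL CLASS LAW», file 2b = memo steps 2–4).  Fix a type-(2) `γ₂ ∈ U₂ = U(σ_w, Φ₂)` of EVEN discriminant depth at a tame-ramified `w ∣ v`
(`(W1)` descent `γ_{2,w} = D_ϖ⁻¹(s·ιg)D_ϖ`, `tr²g − 4det g = ε₀z²`, `ε₀` a non-square unit), `c := ½ tr γ_{2,w}`, and at a coset `hK⁰` (`K⁰ = U ∩ GL₂(𝒪_w)`, the self-dual
lattice `h𝒪_w²`) the MONODROMY `Y_h := E₂(h⁻¹γ₂h)`.  The RESIDUAL CLASS TOKEN with constant `c′ ∈ 𝒪_w^×` and scale `ϖ₁` is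
`CLS_{c′}(Y) :⟺ ∃ y ∈ 𝒪_w², a ∈ 𝒪_w^×, |ϖ₁ · ᵗσ_w(y)·J·(Y − c·1)·y − c′·a²|_w < 1` (`J = antidiag(1,1)`), i.e. the hermitian form `y ↦ ᵗσ(y)J(Y − c)y`, rescaled by `ϖ₁`,
represents the residue class `c̄′·(𝓀^×)²` on the lattice (F0P3a-p07 (g14)'s rank-2 class token in valuation spelling; at an axis vertex it is the `W`-block of the rank-3
socket token `z ⬝ᵥ (redMat Φ₃ · redMat(ϖ⁻¹(x_w − 1))) z = a²`).
(§1) A bijection `Φ` of a group `G` with `h₁⁻¹h₂ ∈ K ⟺ Φh₁⁻¹Φh₂ ∈ K` and `B∘Φ = A` gives `#{hK : A} = #{hK : B}` (`Quotient.congr`).  (§2) For an INTEGRAL similitude `P`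
(`ᵗσPJP = μJ`, `|μ| = 1`, `P, P⁻¹ ∈ M₂(𝒪_w)`): `ᵗσ(Py)J(PNP⁻¹)(Py) = μ·ᵗσ(y)JNy`, so `CLS_{c₀}(PYP⁻¹) ⟺ CLS_{c₁}(Y)` whenever `|c₀ − μc₁| < 1`, and entrywise depth
of `Y − c·1` is `P`-conjugation invariant.  (§3) THE LAW: by ★ file 2a there is a similitude `X₀` commuting with `γ_{2,w}`, normalising `U`, with unit multiplier
`ι(ν) ≡ c₀c₁⁻¹ (mod 𝔭_w)`, and `k₀ ∈ U` with `P := k₀⁻¹X₀ ∈ GL₂(𝒪_w)`; `Φ(h) := X₀hX₀⁻¹k₀` is a bijection of `U₂(L⁺_v) ≅ U` (transported through `E₂`) with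
`E₂(Φg₁)⁻¹E₂(Φg₂) = P·E₂(g₁⁻¹g₂)·P⁻¹` (coset-compatible both ways, `P ∈ GL₂(𝒪_w)`) and `Y_{Φg} = P·Y_g·P⁻¹` (`X₀` commutes with `γ_{2,w}`); hence for every
`GL₂(𝒪_w)`-conjugation-stable family `S` and all units `c₀, c₁`: **`#{hK⁰ : S(Y_h) ∧ CLS_{c₀}(Y_h)} = #{hK⁰ : S(Y_h) ∧ CLS_{c₁}(Y_h)}`**; in particular (§4) on every
DEPTH SHELL `Sh_j = {|Y_h − c|_{ab} ≤ |ϖ^{2j}| ∀ab} ∖ {… ≤ |ϖ^{2(j+1)}|}` with the scale `ϖ₁ = ϖ^{−(2j+1)}` — the two residual classes (`c₁ = εc₀`, `ε` non-square) are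
EQUINUMEROUS on every shell.  Odd depth (ramified torus) has no unit-multiplier flip and is not treated here.

* §1 `natCard_setOf_exists_mk_eq_of_equiv`.
* §2 `conj_sub_smul_one`, `form_conj_apply_mulVec`, `similitude_inv`, `forall_v_mul_mul_apply_le`, **`exists_class_conj_iff`**, `forall_v_conj_sub_smul_one_le_iff`.
* §3 **`natCard_class_eq_natCard_class_of_even_depth_ramified`** (master form, `S` and `ϖ₁` free).
* §4 **`natCard_shell_class_eq_of_even_depth_ramified`** (the shell instance `S = Sh_j`, `ϖ₁ = (ϖ^{2j+1})⁻¹`).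

## References
* [LabesseLanglands1979] J.-P. Labesse, R. P. Langlands, *L-indistinguishability for SL(2)*, Canad. J. Math. 31 (1979): §2 pp. 7–8.
* [Rogawski1990] J. D. Rogawski, *Automorphic Representations of Unitary Groups in Three Variables* (1990): §4.9 pp. 54–56.
* [Jacobowitz1962] R. Jacobowitz, *Hermitian forms over local fields*, Amer. J. Math. 84 (1962): §7–§8.
* [Serre1980Trees] J.-P. Serre, *Trees* (1980): Ch. II §1.1.
-/

set_option autoImplicit false

noncomputable section

open MeasureTheory Measure Set NumberField IsDedekindDomain Matrix ValuativeRel MulAction Finset Polynomial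
open scoped ValuativeRel Matrix MatrixGroups WithZero

namespace Literature.NumberTheory.Automorphic.UnitaryGroup

open Literature.NumberTheory.Rogawski1990 Literature.NumberTheory.Automorphic Literature.NumberTheory.Automorphic.IntegralReduction
open Literature.NumberTheory.Automorphic.HermitianLatticeTree Literature.GroupTheory Literature.NumberTheory.GaloisRepresentations

/-! ## §1 Transport of coset counts along a coset-compatible bijection -/

section Cosets

variable {G : Type*} [Group G]

/-- **TRANSPORT OF COSET COUNTS.**  A bijection `Φ` of `G` with `h₁⁻¹h₂ ∈ K ⟺ Φ(h₁)⁻¹Φ(h₂) ∈ K` descends to a bijection of `G ⧸ K`; if `B ∘ Φ = A` on representatives then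
it maps `{hK : A h}` onto `{hK : B h}`, so the two sets of cosets have the same size (the coset-counting step of the orbital-integral comparison).
[cite: LabesseLanglands1979, §2 p. 8] [cite: Kottwitz1988, §2] -/
theorem natCard_setOf_exists_mk_eq_of_equiv (K : Subgroup G) (Φ : G ≃ G) (hΦ : ∀ h₁ h₂ : G, h₁⁻¹ * h₂ ∈ K ↔ (Φ h₁)⁻¹ * Φ h₂ ∈ K)
    (A B : G → Prop) (hAB : ∀ h, B (Φ h) ↔ A h) :
    Nat.card {x : G ⧸ K | ∃ h : G, x = (h : G ⧸ K) ∧ A h} = Nat.card {x : G ⧸ K | ∃ h : G, x = (h : G ⧸ K) ∧ B h} := by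
  set e : G ⧸ K ≃ G ⧸ K := Quotient.congr (ra := QuotientGroup.leftRel K) (rb := QuotientGroup.leftRel K) Φ
    (fun a b => by rw [QuotientGroup.leftRel_apply, QuotientGroup.leftRel_apply]; exact hΦ a b) with he
  have hemk : ∀ h : G, e (h : G ⧸ K) = ((Φ h : G) : G ⧸ K) := fun h => rfl
  refine Nat.card_congr (e.subtypeEquiv fun x => ?_)
  simp only [Set.mem_setOf_eq]
  constructor
  · rintro ⟨h, rfl, hA⟩
    exact ⟨Φ h, hemk h, (hAB h).2 hA⟩
  · rintro ⟨h', hx, hB⟩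
    obtain ⟨a, rfl⟩ := QuotientGroup.mk_surjective x
    rw [hemk, QuotientGroup.eq] at hx
    refine ⟨Φ.symm h', ?_, (hAB _).1 (by rw [Φ.apply_symm_apply]; exact hB)⟩
    rw [QuotientGroup.eq, hΦ, Φ.apply_symm_apply]
    exact hx

end Cosets

/-! ## §2 Conjugation by an integral similitude: entrywise depth, and the residual class of the hermitian form `ᵗσ(y)·J·(Y − c)·y` -/

section Algebra

variable {E : Type*} [Field E] (σ : E →+* E)

/-- `P(Y − c·1)P′ = PYP′ − c·1` when `PP′ = 1`. [cite: Jacobowitz1962, §7] -/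
theorem conj_sub_smul_one {P P' Y : Matrix (Fin 2) (Fin 2) E} (hPP' : P * P' = 1) (c : E) :
    P * (Y - c • (1 : Matrix (Fin 2) (Fin 2) E)) * P' = P * Y * P' - c • (1 : Matrix (Fin 2) (Fin 2) E) := by
  rw [Matrix.mul_sub, Matrix.sub_mul, Matrix.mul_smul, Matrix.mul_one, Matrix.smul_mul, hPP']

/-- **The hermitian form along a similitude**: if `ᵗσ(P)·J·P = ν·J` and `P′P = 1` then `ᵗσ(Py)·J·(P N P′)(Py) = ν · ᵗσ(y)·J·N·y`. [cite: Jacobowitz1962, §7] -/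
theorem form_conj_apply_mulVec {J P P' N : Matrix (Fin 2) (Fin 2) E} {ν : E} (hP : (P.map σ)ᵀ * J * P = ν • J) (hP'P : P' * P = 1) (y : Fin 2 → E) :
    (fun i => σ ((P *ᵥ y) i)) ⬝ᵥ (J *ᵥ ((P * N * P') *ᵥ (P *ᵥ y))) = ν * ((fun i => σ (y i)) ⬝ᵥ (J *ᵥ (N *ᵥ y))) := by
  have h1 : (fun i => σ ((P *ᵥ y) i)) = P.map σ *ᵥ (fun i => σ (y i)) := by
    funext i; rw [RingHom.map_mulVec]; rfl
  have h2 : (P * N * P') *ᵥ (P *ᵥ y) = P *ᵥ (N *ᵥ y) := by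
    rw [Matrix.mulVec_mulVec, Matrix.mul_assoc, hP'P, Matrix.mul_one, Matrix.mulVec_mulVec]
  rw [h1, h2, ← Matrix.vecMul_transpose, ← Matrix.dotProduct_mulVec, Matrix.mulVec_mulVec, Matrix.mulVec_mulVec, hP, Matrix.smul_mulVec, dotProduct_smul, smul_eq_mul]

/-- **The inverse of a similitude is a similitude with the inverse multiplier**: `ᵗσ(X)JX = νJ`, `ν ≠ 0` ⟹ `ᵗσ(X⁻¹)JX⁻¹ = ν⁻¹J`. [cite: Jacobowitz1962, §7] -/
theorem similitude_inv {J : Matrix (Fin 2) (Fin 2) E} (X : GL (Fin 2) E) {ν : E} (hν : ν ≠ 0)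
    (hX : ((X : Matrix (Fin 2) (Fin 2) E).map σ)ᵀ * J * (X : Matrix (Fin 2) (Fin 2) E) = ν • J) :
    (((X⁻¹ : GL (Fin 2) E) : Matrix (Fin 2) (Fin 2) E).map σ)ᵀ * J * ((X⁻¹ : GL (Fin 2) E) : Matrix (Fin 2) (Fin 2) E) = ν⁻¹ • J := by
  have h1 : (((X⁻¹ : GL (Fin 2) E) : Matrix (Fin 2) (Fin 2) E).map σ)ᵀ * ((X : Matrix (Fin 2) (Fin 2) E).map σ)ᵀ = 1 := by
    rw [← Matrix.transpose_mul, ← Matrix.map_mul, ← Units.val_mul, mul_inv_cancel, Units.val_one, Matrix.map_one σ (map_zero σ) (map_one σ), Matrix.transpose_one]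
  have h2 : (X : Matrix (Fin 2) (Fin 2) E) * ((X⁻¹ : GL (Fin 2) E) : Matrix (Fin 2) (Fin 2) E) = 1 := by rw [← Units.val_mul, mul_inv_cancel, Units.val_one]
  have hJ : J = ν⁻¹ • (((X : Matrix (Fin 2) (Fin 2) E).map σ)ᵀ * J * (X : Matrix (Fin 2) (Fin 2) E)) := by rw [hX, smul_smul, inv_mul_cancel₀ hν, one_smul]
  calc (((X⁻¹ : GL (Fin 2) E) : Matrix (Fin 2) (Fin 2) E).map σ)ᵀ * J * ((X⁻¹ : GL (Fin 2) E) : Matrix (Fin 2) (Fin 2) E)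
      = (((X⁻¹ : GL (Fin 2) E) : Matrix (Fin 2) (Fin 2) E).map σ)ᵀ * (ν⁻¹ • (((X : Matrix (Fin 2) (Fin 2) E).map σ)ᵀ * J * (X : Matrix (Fin 2) (Fin 2) E))) * ((X⁻¹ : GL (Fin 2) E) : Matrix (Fin 2) (Fin 2) E) := by
        rw [← hJ]
    _ = ν⁻¹ • (((((X⁻¹ : GL (Fin 2) E) : Matrix (Fin 2) (Fin 2) E).map σ)ᵀ * ((X : Matrix (Fin 2) (Fin 2) E).map σ)ᵀ) * J * ((X : Matrix (Fin 2) (Fin 2) E) * ((X⁻¹ : GL (Fin 2) E) : Matrix (Fin 2) (Fin 2) E))) := by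
        simp only [Matrix.mul_smul, Matrix.smul_mul, Matrix.mul_assoc]
    _ = ν⁻¹ • J := by rw [h1, h2, Matrix.one_mul, Matrix.mul_one]

end Algebra

section Transport

variable {K : Type*} [Field K] [NumberField K] (w₁ : HeightOneSpectrum (𝓞 K)) (σ : w₁.adicCompletion K →+* w₁.adicCompletion K)

/-- **Entrywise depth is invariant under integral conjugation**: if all entries of `M` have `|·| ≤ r` and `P, P′` have integral entries then all entries of `P·M·P′` have `|·| ≤ r`.
[cite: Serre1980Trees, Ch. II §1.1] -/
theorem forall_v_mul_mul_apply_le {P P' M : Matrix (Fin 2) (Fin 2) (w₁.adicCompletion K)} (hP : ∀ a b, Valued.v (P a b) ≤ 1) (hP' : ∀ a b, Valued.v (P' a b) ≤ 1)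
    {r : WithZero (Multiplicative ℤ)} (hM : ∀ a b, Valued.v (M a b) ≤ r) (a b : Fin 2) : Valued.v ((P * M * P') a b) ≤ r := by
  have hPM : ∀ i k, Valued.v ((P * M) i k) ≤ r := fun i k => by
    rw [Matrix.mul_apply, Fin.sum_univ_two]
    refine le_trans (Valuation.map_add _ _ _) (max_le ?_ ?_) <;> rw [map_mul] <;>
      exact le_trans (mul_le_mul' (hP _ _) (hM _ _)) (by rw [one_mul])
  rw [Matrix.mul_apply, Fin.sum_univ_two]
  refine le_trans (Valuation.map_add _ _ _) (max_le ?_ ?_) <;> rw [map_mul] <;>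
    exact le_trans (mul_le_mul' (hPM _ _) (hP' _ _)) (by rw [mul_one])

/-- **TRANSPORT OF THE RESIDUAL CLASS along an integral unit-multiplier similitude.**  Let `ᵗσ(P)JP = μJ` with `|μ| = 1`, `P, P⁻¹` integral, and `|c₀ − μc₁| < 1`.  Then the class
token `∃ y ∈ 𝒪², a ∈ 𝒪^×, |ϖ₁·ᵗσ(y)J(Y′ − c)y − c₀a²| < 1` for `Y′ = PYP⁻¹` is equivalent to the same token for `Y` with constant `c₁` (`y ↦ P⁻¹y`; `ϖ₁` any scalar, e.g.
`ϖ^{−(2j+1)}`). [cite: Jacobowitz1962, §7] [cite: Rogawski1990, §4.9 p. 55] -/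
theorem exists_class_conj_iff {J : Matrix (Fin 2) (Fin 2) (w₁.adicCompletion K)} {P P' : Matrix (Fin 2) (Fin 2) (w₁.adicCompletion K)} {μ : (w₁.adicCompletion K)} (hP : (P.map σ)ᵀ * J * P = μ • J) (hμ : Valued.v μ = 1)
    (hPP' : P * P' = 1) (hP'P : P' * P = 1) (hPi : ∀ a b, Valued.v (P a b) ≤ 1) (hP'i : ∀ a b, Valued.v (P' a b) ≤ 1)
    {c₀ c₁ : (w₁.adicCompletion K)} (hc : Valued.v (c₀ - μ * c₁) < 1) (ϖ₁ c : (w₁.adicCompletion K)) (Y : Matrix (Fin 2) (Fin 2) (w₁.adicCompletion K)) :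
    (∃ (y : Fin 2 → (w₁.adicCompletion K)) (a : (w₁.adicCompletion K)), (∀ i, Valued.v (y i) ≤ 1) ∧ Valued.v a = 1 ∧
        Valued.v (ϖ₁ * ((fun i => σ (y i)) ⬝ᵥ (J *ᵥ ((P * Y * P' - c • (1 : Matrix (Fin 2) (Fin 2) (w₁.adicCompletion K))) *ᵥ y))) - c₀ * a ^ 2) < 1) ↔
      (∃ (y : Fin 2 → (w₁.adicCompletion K)) (a : (w₁.adicCompletion K)), (∀ i, Valued.v (y i) ≤ 1) ∧ Valued.v a = 1 ∧
        Valued.v (ϖ₁ * ((fun i => σ (y i)) ⬝ᵥ (J *ᵥ ((Y - c • (1 : Matrix (Fin 2) (Fin 2) (w₁.adicCompletion K))) *ᵥ y))) - c₁ * a ^ 2) < 1) := by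
  have hμ0 : μ ≠ 0 := fun h0 => by rw [h0, map_zero] at hμ; exact zero_ne_one hμ
  -- integral vectors stay integral under `P`, `P′`
  have hint : ∀ (Q : Matrix (Fin 2) (Fin 2) (w₁.adicCompletion K)), (∀ a b, Valued.v (Q a b) ≤ 1) → ∀ y : Fin 2 → (w₁.adicCompletion K), (∀ i, Valued.v (y i) ≤ 1) → ∀ i, Valued.v ((Q *ᵥ y) i) ≤ 1 := by
    intro Q hQ y hy i
    rw [Matrix.mulVec, dotProduct, Fin.sum_univ_two]
    refine le_trans (Valuation.map_add _ _ _) (max_le ?_ ?_) <;> rw [map_mul] <;>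
      exact le_trans (mul_le_mul' (hQ _ _) (hy _)) (by rw [one_mul])
  -- the key identity on `y = P y₁`
  have key : ∀ y₁ : Fin 2 → (w₁.adicCompletion K), (fun i => σ ((P *ᵥ y₁) i)) ⬝ᵥ (J *ᵥ ((P * Y * P' - c • (1 : Matrix (Fin 2) (Fin 2) (w₁.adicCompletion K))) *ᵥ (P *ᵥ y₁))) =
      μ * ((fun i => σ (y₁ i)) ⬝ᵥ (J *ᵥ ((Y - c • (1 : Matrix (Fin 2) (Fin 2) (w₁.adicCompletion K))) *ᵥ y₁))) := fun y₁ => by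
    rw [← conj_sub_smul_one hPP' c]; exact form_conj_apply_mulVec σ hP hP'P y₁
  -- `|x − c₀a²| < 1 ⟺ |μ⁻¹x − c₁a²| < 1` for a unit `a`
  have hflip : ∀ (x a : (w₁.adicCompletion K)), Valued.v a = 1 → (Valued.v (x - c₀ * a ^ 2) < 1 ↔ Valued.v (μ⁻¹ * x - c₁ * a ^ 2) < 1) := by
    intro x a ha
    have hδ : Valued.v ((μ⁻¹ * c₀ - c₁) * a ^ 2) < 1 := by
      rw [map_mul, map_pow, ha, one_pow, mul_one, show μ⁻¹ * c₀ - c₁ = μ⁻¹ * (c₀ - μ * c₁) by field_simp, map_mul, map_inv₀, hμ, inv_one, one_mul]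
      exact hc
    have e1 : μ⁻¹ * x - c₁ * a ^ 2 = μ⁻¹ * (x - c₀ * a ^ 2) + (μ⁻¹ * c₀ - c₁) * a ^ 2 := by ring
    have e2 : x - c₀ * a ^ 2 = μ * (μ⁻¹ * x - c₁ * a ^ 2) - μ * ((μ⁻¹ * c₀ - c₁) * a ^ 2) := by field_simp; ring
    constructor
    · intro h
      rw [e1]
      refine lt_of_le_of_lt (Valuation.map_add _ _ _) (max_lt ?_ hδ)
      rw [map_mul, map_inv₀, hμ, inv_one, one_mul]; exact h
    · intro h
      rw [e2]
      refine lt_of_le_of_lt (Valuation.map_sub _ _ _) (max_lt ?_ ?_)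
      · rw [map_mul, hμ, one_mul]; exact h
      · rw [map_mul, hμ, one_mul]; exact hδ
  constructor
  · rintro ⟨y, a, hy, ha, hlt⟩
    refine ⟨P' *ᵥ y, a, hint P' hP'i y hy, ha, ?_⟩
    have hy1 : P *ᵥ (P' *ᵥ y) = y := by rw [Matrix.mulVec_mulVec, hPP', Matrix.one_mulVec]
    rw [← hy1, key, ← mul_assoc, mul_comm ϖ₁ μ, mul_assoc] at hlt
    rw [(hflip _ a ha)] at hlt
    rwa [← mul_assoc, inv_mul_cancel₀ hμ0, one_mul] at hlt
  · rintro ⟨y₁, a, hy₁, ha, hlt⟩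
    refine ⟨P *ᵥ y₁, a, hint P hPi y₁ hy₁, ha, ?_⟩
    rw [key, ← mul_assoc, mul_comm ϖ₁ μ, mul_assoc, hflip _ a ha, ← mul_assoc, inv_mul_cancel₀ hμ0, one_mul]
    exact hlt

/-- **Entrywise depth of `Y − c·1` is invariant under integral conjugation** (`Y ↦ PYP⁻¹`, `P ∈ GL₂(𝒪)`). [cite: Serre1980Trees, Ch. II §1.1] -/
theorem forall_v_conj_sub_smul_one_le_iff {P P' : Matrix (Fin 2) (Fin 2) (w₁.adicCompletion K)} (hPP' : P * P' = 1) (hP'P : P' * P = 1)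
    (hPi : ∀ a b, Valued.v (P a b) ≤ 1) (hP'i : ∀ a b, Valued.v (P' a b) ≤ 1) (c : (w₁.adicCompletion K)) (Y : Matrix (Fin 2) (Fin 2) (w₁.adicCompletion K)) (r : WithZero (Multiplicative ℤ)) :
    (∀ a b, Valued.v ((P * Y * P' - c • (1 : Matrix (Fin 2) (Fin 2) (w₁.adicCompletion K))) a b) ≤ r) ↔ (∀ a b, Valued.v ((Y - c • (1 : Matrix (Fin 2) (Fin 2) (w₁.adicCompletion K))) a b) ≤ r) := by
  rw [← conj_sub_smul_one hPP' c]
  constructor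
  · intro h a b
    have e : Y - c • (1 : Matrix (Fin 2) (Fin 2) (w₁.adicCompletion K)) = P' * (P * (Y - c • (1 : Matrix (Fin 2) (Fin 2) (w₁.adicCompletion K))) * P') * P := by
      calc Y - c • (1 : Matrix (Fin 2) (Fin 2) (w₁.adicCompletion K)) = (P' * P) * (Y - c • (1 : Matrix (Fin 2) (Fin 2) (w₁.adicCompletion K))) * (P' * P) := by rw [hP'P, Matrix.one_mul, Matrix.mul_one]
        _ = _ := by simp only [Matrix.mul_assoc]
    rw [e]
    exact forall_v_mul_mul_apply_le w₁ hP'i hPi h a b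
  · intro h a b
    exact forall_v_mul_mul_apply_le w₁ hPi hP'i h a b

end Transport

/-! ## §3 THE SHELL CLASS LAW at even depth: the residual class count on any `GL₂(𝒪_w)`-conjugation-stable family of `K⁰`-cosets is independent of the class constant -/

section ClassLaw

variable (L : Type) [Field L] [NumberField L] [IsCMField L] (v : HeightOneSpectrum (𝓞 ↥(maximalRealSubfield L)))
  (w : PlacesOver L v) (hw : IsCMField.complexConj L • w.1 = w.1)

set_option maxHeartbeats 1600000 in
include hw in
/-- **THE SHELL CLASS LAW (MASTER FORM).**  Let `γ₂ ∈ U₂` be of type (2) at a tame-ramified place (no root of `χ_{γ₂,w}` in `L_w`), of EVEN discriminant depth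
`|tr² − 4det|_w = exp(−2·2n)`, `n ≥ 1`; put `c := ½ tr γ_{2,w}`, `Y_h := E₂(h⁻¹γ₂h)` (the monodromy at the coset `hK⁰`), and for a unit `c′` and a scalar `ϖ₁` let
`CLS_{c′}(Y) :⟺ ∃ y ∈ 𝒪_w², a ∈ 𝒪_w^×, |ϖ₁·ᵗσ_w(y)·J·(Y − c·1)·y − c′a²|_w < 1` (`J = antidiag(1,1)`; the RESIDUAL CLASS of the hermitian form `ᵗσ(y)J(Y − c)y` rescaled by
`ϖ₁`).  Then for every family `S` of matrices stable under `GL₂(𝒪_w)`-conjugation and all units `c₀, c₁`: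
**`#{hK⁰ : S(Y_h) ∧ CLS_{c₀}(Y_h)} = #{hK⁰ : S(Y_h) ∧ CLS_{c₁}(Y_h)}`** — the class count does not depend on the class constant.  PROOF: the class-flipping similitude
`X₀` (★ file 2a, multiplier `ι(ν) ≡ c₀c₁⁻¹`) commutes with `γ_{2,w}` and normalises `U`; with its unitary correction `k₀` (`P := k₀⁻¹X₀ ∈ GL₂(𝒪_w)`) the map
`h ↦ X₀hX₀⁻¹k₀` is a bijection of `U₂` compatible with `K⁰`-cosets in both directions, under which `Y ↦ PYP⁻¹`; `S` is stable and `CLS_{c₀}(PYP⁻¹) ⟺ CLS_{c₁}(Y)` (§2).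
(Organ (B-ii) of the (α₂) line; F0P3a-p07 (g14)'s (Cnt2′) collar census consumes the shell instance below.) [cite: LabesseLanglands1979, §2 pp. 7–8] [cite: Rogawski1990, §4.9 p. 55]
[cite: Jacobowitz1962, §8] -/
theorem natCard_class_eq_natCard_class_of_even_depth_ramified (he : v.asIdeal.ramificationIdx' w.1.asIdeal ≠ 1) (h2 : IsUnit (2 : 𝒪[(w.1.adicCompletion L)]))
    (ϖ : (w.1.adicCompletion L)ˣ) (hϖ : Valued.v (ϖ : (w.1.adicCompletion L)) = WithZero.exp (-1 : ℤ))
    (hσϖ : (galAdicCompletionMap (L := L) (IsCMField.complexConj L) hw) (ϖ : (w.1.adicCompletion L)) = -(ϖ : (w.1.adicCompletion L)))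
    (γ₂ : ((cmDatum L 2 (Matrix.of fun i j : Fin 2 => if i.val + j.val + 1 = 2 then (1 : L) else 0)).Local v))
    (hirr : ¬ ∃ x : (w.1.adicCompletion L), ((((((localNonsplitEquiv (IsCMField.complexConj L) (Matrix.of fun i j : Fin 2 => if i.val + j.val + 1 = 2 then (1 : L) else 0) (IsCMField.complexConj_ne_one L) w hw) (γ₂) : ↥(unitaryGroupOfForm (galAdicCompletionMap (L := L) (IsCMField.complexConj L) hw) (placeForm (Matrix.of fun i j : Fin 2 => if i.val + j.val + 1 = 2 then (1 : L) else 0) w.1))) : GL (Fin 2) (w.1.adicCompletion L)) : Matrix (Fin 2) (Fin 2) (w.1.adicCompletion L))).charpoly).IsRoot x)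
    {n : ℕ} (hn1 : 1 ≤ n) (hN : Valued.v ((((((localNonsplitEquiv (IsCMField.complexConj L) (Matrix.of fun i j : Fin 2 => if i.val + j.val + 1 = 2 then (1 : L) else 0) (IsCMField.complexConj_ne_one L) w hw) (γ₂) : ↥(unitaryGroupOfForm (galAdicCompletionMap (L := L) (IsCMField.complexConj L) hw) (placeForm (Matrix.of fun i j : Fin 2 => if i.val + j.val + 1 = 2 then (1 : L) else 0) w.1))) : GL (Fin 2) (w.1.adicCompletion L)) : Matrix (Fin 2) (Fin 2) (w.1.adicCompletion L))).trace ^ 2 - 4 * (((((localNonsplitEquiv (IsCMField.complexConj L) (Matrix.of fun i j : Fin 2 => if i.val + j.val + 1 = 2 then (1 : L) else 0) (IsCMField.complexConj_ne_one L) w hw) (γ₂) : ↥(unitaryGroupOfForm (galAdicCompletionMap (L := L) (IsCMField.complexConj L) hw) (placeForm (Matrix.of fun i j : Fin 2 => if i.val + j.val + 1 = 2 then (1 : L) else 0) w.1))) : GL (Fin 2) (w.1.adicCompletion L)) : Matrix (Fin 2) (Fin 2) (w.1.adicCompletion L))).det) = WithZero.exp (-((2 * (2 * n) : ℕ) : 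ℤ)))
    (S : Matrix (Fin 2) (Fin 2) (w.1.adicCompletion L) → Prop) (hS : ∀ P : GL (Fin 2) (w.1.adicCompletion L), P ∈ glInt 2 (w.1.adicCompletion L) → ∀ Y : Matrix (Fin 2) (Fin 2) (w.1.adicCompletion L), S Y → S ((P : Matrix (Fin 2) (Fin 2) (w.1.adicCompletion L)) * Y * ((P⁻¹ : GL (Fin 2) (w.1.adicCompletion L)) : Matrix (Fin 2) (Fin 2) (w.1.adicCompletion L))))
    (ϖ₁ : (w.1.adicCompletion L)) {c₀ c₁ : (w.1.adicCompletion L)} (hc₀ : Valued.v c₀ = 1) (hc₁ : Valued.v c₁ = 1) :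
    Nat.card {x : ((cmDatum L 2 (Matrix.of fun i j : Fin 2 => if i.val + j.val + 1 = 2 then (1 : L) else 0)).Local v) ⧸ (cmLocalIntegralLevel L 2 (Matrix.of fun i j : Fin 2 => if i.val + j.val + 1 = 2 then (1 : L) else 0) v) | ∃ h : ((cmDatum L 2 (Matrix.of fun i j : Fin 2 => if i.val + j.val + 1 = 2 then (1 : L) else 0)).Local v), x = (h : ((cmDatum L 2 (Matrix.of fun i j : Fin 2 => if i.val + j.val + 1 = 2 then (1 : L) else 0)).Local v) ⧸ (cmLocalIntegralLevel L 2 (Matrix.of fun i j : Fin 2 => if i.val + j.val + 1 = 2 then (1 : L) else 0) v)) ∧ S (((((localNonsplitEquiv (IsCMField.complexConj L) (Matrix.of fun i j : Fin 2 => if i.val + j.val + 1 = 2 then (1 : L) else 0) (IsCMField.complexConj_ne_one L) w hw) (h⁻¹ * γ₂ * h) : ↥(unitaryGroupOfForm (galAdicCompletionMap (L := L) (IsCMField.complexConj L) hw) (placeForm (Matrix.of fun i j : Fin 2 => if i.val + j.val + 1 = 2 then (1 : L) else 0) w.1))) : GL (Fin 2) (w.1.adicCompletion L)) : Matrix (Fin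 2) (Fin 2) (w.1.adicCompletion L))) ∧
      ∃ (y : Fin 2 → (w.1.adicCompletion L)) (a : (w.1.adicCompletion L)), (∀ i, Valued.v (y i) ≤ 1) ∧ Valued.v a = 1 ∧
        Valued.v (ϖ₁ * ((fun i => (galAdicCompletionMap (L := L) (IsCMField.complexConj L) hw) (y i)) ⬝ᵥ (!![(0 : (w.1.adicCompletion L)), 1; 1, 0] *ᵥ ((((((localNonsplitEquiv (IsCMField.complexConj L) (Matrix.of fun i j : Fin 2 => if i.val + j.val + 1 = 2 then (1 : L) else 0) (IsCMField.complexConj_ne_one L) w hw) (h⁻¹ * γ₂ * h) : ↥(unitaryGroupOfForm (galAdicCompletionMap (L := L) (IsCMField.complexConj L) hw) (placeForm (Matrix.of fun i j : Fin 2 => if i.val + j.val + 1 = 2 then (1 : L) else 0) w.1))) : GL (Fin 2) (w.1.adicCompletion L)) : Matrix (Fin 2) (Fin 2) (w.1.adicCompletion L)) - ((((((localNonsplitEquiv (IsCMField.complexConj L) (Matrix.of fun i j : Fin 2 => if i.val + j.val + 1 = 2 then (1 : L) else 0) (IsCMField.complexConj_ne_one L) w hw) (γ₂) : ↥(unitaryGroupOfForm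 (galAdicCompletionMap (L := L) (IsCMField.complexConj L) hw) (placeForm (Matrix.of fun i j : Fin 2 => if i.val + j.val + 1 = 2 then (1 : L) else 0) w.1))) : GL (Fin 2) (w.1.adicCompletion L)) : Matrix (Fin 2) (Fin 2) (w.1.adicCompletion L))).trace / 2) • (1 : Matrix (Fin 2) (Fin 2) (w.1.adicCompletion L))) *ᵥ y))) - c₀ * a ^ 2) < 1} =
    Nat.card {x : ((cmDatum L 2 (Matrix.of fun i j : Fin 2 => if i.val + j.val + 1 = 2 then (1 : L) else 0)).Local v) ⧸ (cmLocalIntegralLevel L 2 (Matrix.of fun i j : Fin 2 => if i.val + j.val + 1 = 2 then (1 : L) else 0) v) | ∃ h : ((cmDatum L 2 (Matrix.of fun i j : Fin 2 => if i.val + j.val + 1 = 2 then (1 : L) else 0)).Local v), x = (h : ((cmDatum L 2 (Matrix.of fun i j : Fin 2 => if i.val + j.val + 1 = 2 then (1 : L) else 0)).Local v) ⧸ (cmLocalIntegralLevel L 2 (Matrix.of fun i j : Fin 2 => if i.val + j.val + 1 = 2 then (1 : L) else 0) v)) ∧ S (((((localNonsplitEquiv (IsCMField.complexConj L) (Matrix.of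 fun i j : Fin 2 => if i.val + j.val + 1 = 2 then (1 : L) else 0) (IsCMField.complexConj_ne_one L) w hw) (h⁻¹ * γ₂ * h) : ↥(unitaryGroupOfForm (galAdicCompletionMap (L := L) (IsCMField.complexConj L) hw) (placeForm (Matrix.of fun i j : Fin 2 => if i.val + j.val + 1 = 2 then (1 : L) else 0) w.1))) : GL (Fin 2) (w.1.adicCompletion L)) : Matrix (Fin 2) (Fin 2) (w.1.adicCompletion L))) ∧
      ∃ (y : Fin 2 → (w.1.adicCompletion L)) (a : (w.1.adicCompletion L)), (∀ i, Valued.v (y i) ≤ 1) ∧ Valued.v a = 1 ∧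
        Valued.v (ϖ₁ * ((fun i => (galAdicCompletionMap (L := L) (IsCMField.complexConj L) hw) (y i)) ⬝ᵥ (!![(0 : (w.1.adicCompletion L)), 1; 1, 0] *ᵥ ((((((localNonsplitEquiv (IsCMField.complexConj L) (Matrix.of fun i j : Fin 2 => if i.val + j.val + 1 = 2 then (1 : L) else 0) (IsCMField.complexConj_ne_one L) w hw) (h⁻¹ * γ₂ * h) : ↥(unitaryGroupOfForm (galAdicCompletionMap (L := L) (IsCMField.complexConj L) hw) (placeForm (Matrix.of fun i j : Fin 2 => if i.val + j.val + 1 = 2 then (1 : L) else 0) w.1))) : GL (Fin 2) (w.1.adicCompletion L)) : Matrix (Fin 2) (Fin 2) (w.1.adicCompletion L)) - ((((((localNonsplitEquiv (IsCMField.complexConj L) (Matrix.of fun i j : Fin 2 => if i.val + j.val + 1 = 2 then (1 : L) else 0) (IsCMField.complexConj_ne_one L) w hw) (γ₂) : ↥(unitaryGroupOfForm (galAdicCompletionMap (L := L) (IsCMField.complexConj L) hw) (placeForm (Matrix.of fun i j : Fin 2 => if i.val + j.val + 1 = 2 then (1 : L) else 0) w.1))) : GL (Fin 2) (w.1.adicCompletion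 L)) : Matrix (Fin 2) (Fin 2) (w.1.adicCompletion L))).trace / 2) • (1 : Matrix (Fin 2) (Fin 2) (w.1.adicCompletion L))) *ᵥ y))) - c₁ * a ^ 2) < 1} := by
  have hϖ0 : (ϖ : (w.1.adicCompletion L)) ≠ 0 := ϖ.ne_zero
  obtain ⟨h2v, -⟩ := valued_two_eq_one_of_isUnit_two_of_ramified L v w hw he h2
  have hc₁0 : c₁ ≠ 0 := fun h0 => by rw [h0, map_zero] at hc₁; exact zero_ne_one hc₁
  -- the one-place element, its (W1) descent, the non-square unit, the parity (★ p847118)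
  have hu := coe_mem_unitaryGroupOfForm_antidiag_two_of_mem_placeForm L w hw ((localNonsplitEquiv (IsCMField.complexConj L) (Matrix.of fun i j : Fin 2 => if i.val + j.val + 1 = 2 then (1 : L) else 0) (IsCMField.complexConj_ne_one L) w hw) γ₂)
  obtain ⟨s, g, hs, hsg⟩ := descent_of_mem_unitaryGroupOfForm_antidiag L v w hw hσϖ hϖ0 _ hu
  obtain ⟨ε₀, hε₀, hns⟩ := exists_forall_valuation_sq_sub_eq_one L v h2v
  have hϖF := HeckeCharacter.valued_uniformizer (K := ↥(maximalRealSubfield L)) v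
  obtain ⟨-, z, hz, hD, -⟩ := descent_trace_ne_zero_and_exists_eq_nonsquare_mul_sq_of_even_of_ramified L v w hw he h2v hu hirr hn1 hN hϖ0
    (g := (g : Matrix (Fin 2) (Fin 2) (v.adicCompletion ↥(maximalRealSubfield L)))) hsg hns hϖF
  -- the class-flipping similitude with `ι(ν) ≡ c₀c₁⁻¹`, and its unitary correction
  obtain ⟨X₀, ν, hsim, hν, hνc, hcomm, hnorm⟩ := exists_classFlip_similitude_of_unit L v w hw he h2v ϖ hϖ hσϖ ((localNonsplitEquiv (IsCMField.complexConj L) (Matrix.of fun i j : Fin 2 => if i.val + j.val + 1 = 2 then (1 : L) else 0) (IsCMField.complexConj_ne_one L) w hw) γ₂) hsg hε₀ hns hz hD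
    (c := c₀ * c₁⁻¹) (by rw [map_mul, map_inv₀, hc₀, hc₁, inv_one, mul_one])
  obtain ⟨k₀, hk₀U, hPint⟩ := exists_unitary_inv_mul_mem_glInt_of_similitude L v w hw he h2 X₀ hν hsim
  have hk₀J : k₀ ∈ unitaryGroupOfForm (galAdicCompletionMap (L := L) (IsCMField.complexConj L) hw) !![(0 : (w.1.adicCompletion L)), 1; 1, 0] := by
    rw [← unitaryGroupOfForm_placeForm_antidiagTwo_eq]; exact hk₀U
  have hιν : Valued.v (toPlace v w ν) = 1 := by rw [valued_toPlace, (v_eq_one_iff_valuation_eq_one _).2 hν, one_pow]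
  have hιν0 : toPlace v w ν ≠ 0 := fun h0 => by rw [h0, map_zero] at hιν; exact zero_ne_one hιν
  -- `X₀⁻¹` normalises `U` as well
  have hsim' := similitude_inv (galAdicCompletionMap (L := L) (IsCMField.complexConj L) hw) X₀ hιν0 hsim
  have hnorm' : ∀ h : GL (Fin 2) (w.1.adicCompletion L), h ∈ unitaryGroupOfForm (galAdicCompletionMap (L := L) (IsCMField.complexConj L) hw) (placeForm (Matrix.of fun i j : Fin 2 => if i.val + j.val + 1 = 2 then (1 : L) else 0) w.1) → X₀⁻¹ * h * X₀ ∈ unitaryGroupOfForm (galAdicCompletionMap (L := L) (IsCMField.complexConj L) hw) (placeForm (Matrix.of fun i j : Fin 2 => if i.val + j.val + 1 = 2 then (1 : L) else 0) w.1) := by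
    intro h hh
    rw [unitaryGroupOfForm_placeForm_antidiagTwo_eq] at hh ⊢
    have h1 := conj_mem_unitaryGroupOfForm_of_similitude (galAdicCompletionMap (L := L) (IsCMField.complexConj L) hw) X₀⁻¹ hsim' h hh
    rwa [inv_inv] at h1
  -- GL-level commutation with `u = E₂ γ₂`
  have hcommGL : X₀ * (((localNonsplitEquiv (IsCMField.complexConj L) (Matrix.of fun i j : Fin 2 => if i.val + j.val + 1 = 2 then (1 : L) else 0) (IsCMField.complexConj_ne_one L) w hw) γ₂ : ↥(unitaryGroupOfForm (galAdicCompletionMap (L := L) (IsCMField.complexConj L) hw) (placeForm (Matrix.of fun i j : Fin 2 => if i.val + j.val + 1 = 2 then (1 : L) else 0) w.1))) : GL (Fin 2) (w.1.adicCompletion L)) = (((localNonsplitEquiv (IsCMField.complexConj L) (Matrix.of fun i j : Fin 2 => if i.val + j.val + 1 = 2 then (1 : L) else 0) (IsCMField.complexConj_ne_one L) w hw) γ₂ : ↥(unitaryGroupOfForm (galAdicCompletionMap (L := L) (IsCMField.complexConj L) hw) (placeForm (Matrix.of fun i j : Fin 2 => if i.val + j.val + 1 = 2 then (1 : L) else 0)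 w.1))) : GL (Fin 2) (w.1.adicCompletion L)) * X₀ :=
    Units.ext (by rw [Units.val_mul, Units.val_mul]; exact hcomm)
  have hconjX : X₀⁻¹ * (((localNonsplitEquiv (IsCMField.complexConj L) (Matrix.of fun i j : Fin 2 => if i.val + j.val + 1 = 2 then (1 : L) else 0) (IsCMField.complexConj_ne_one L) w hw) γ₂ : ↥(unitaryGroupOfForm (galAdicCompletionMap (L := L) (IsCMField.complexConj L) hw) (placeForm (Matrix.of fun i j : Fin 2 => if i.val + j.val + 1 = 2 then (1 : L) else 0) w.1))) : GL (Fin 2) (w.1.adicCompletion L)) * X₀ = (((localNonsplitEquiv (IsCMField.complexConj L) (Matrix.of fun i j : Fin 2 => if i.val + j.val + 1 = 2 then (1 : L) else 0) (IsCMField.complexConj_ne_one L) w hw) γ₂ : ↥(unitaryGroupOfForm (galAdicCompletionMap (L := L) (IsCMField.complexConj L) hw) (placeForm (Matrix.of fun i j : Fin 2 => if i.val + j.val + 1 = 2 then (1 : L) else 0) w.1))) : GL (Fin 2) (w.1.adicCompletion L)) := by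
    rw [mul_assoc, ← hcommGL, inv_mul_cancel_left]
  -- the bijection `h ↦ X₀ h X₀⁻¹ k₀` of `U₂(L⁺_v) ≅ U`
  set k₀' : ↥(unitaryGroupOfForm (galAdicCompletionMap (L := L) (IsCMField.complexConj L) hw) (placeForm (Matrix.of fun i j : Fin 2 => if i.val + j.val + 1 = 2 then (1 : L) else 0) w.1)) := ⟨k₀, hk₀U⟩ with hk₀'
  set ΦU : ↥(unitaryGroupOfForm (galAdicCompletionMap (L := L) (IsCMField.complexConj L) hw) (placeForm (Matrix.of fun i j : Fin 2 => if i.val + j.val + 1 = 2 then (1 : L) else 0) w.1)) ≃ ↥(unitaryGroupOfForm (galAdicCompletionMap (L := L) (IsCMField.complexConj L) hw) (placeForm (Matrix.of fun i j : Fin 2 => if i.val + j.val + 1 = 2 then (1 : L) else 0) w.1)) :=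
    { toFun := fun h => ⟨X₀ * (h : GL (Fin 2) (w.1.adicCompletion L)) * X₀⁻¹, hnorm _ h.2⟩ * k₀'
      invFun := fun h' => ⟨X₀⁻¹ * ((h' * k₀'⁻¹ : ↥(unitaryGroupOfForm (galAdicCompletionMap (L := L) (IsCMField.complexConj L) hw) (placeForm (Matrix.of fun i j : Fin 2 => if i.val + j.val + 1 = 2 then (1 : L) else 0) w.1))) : GL (Fin 2) (w.1.adicCompletion L)) * X₀, hnorm' _ (h' * k₀'⁻¹).2⟩
      left_inv := fun h => by
        apply Subtype.ext
        simp only [Subgroup.coe_mul, Subgroup.coe_inv, hk₀']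
        group
      right_inv := fun h' => by
        apply Subtype.ext
        simp only [Subgroup.coe_mul, Subgroup.coe_inv, hk₀']
        group } with hΦU
  have hΦU_apply : ∀ h : ↥(unitaryGroupOfForm (galAdicCompletionMap (L := L) (IsCMField.complexConj L) hw) (placeForm (Matrix.of fun i j : Fin 2 => if i.val + j.val + 1 = 2 then (1 : L) else 0) w.1)), ((ΦU h : ↥(unitaryGroupOfForm (galAdicCompletionMap (L := L) (IsCMField.complexConj L) hw) (placeForm (Matrix.of fun i j : Fin 2 => if i.val + j.val + 1 = 2 then (1 : L) else 0) w.1))) : GL (Fin 2) (w.1.adicCompletion L)) = X₀ * (h : GL (Fin 2) (w.1.adicCompletion L)) * X₀⁻¹ * k₀ := fun h => rfl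
  set Φ : ((cmDatum L 2 (Matrix.of fun i j : Fin 2 => if i.val + j.val + 1 = 2 then (1 : L) else 0)).Local v) ≃ ((cmDatum L 2 (Matrix.of fun i j : Fin 2 => if i.val + j.val + 1 = 2 then (1 : L) else 0)).Local v) :=
    { toFun := fun g => ((localNonsplitEquiv (IsCMField.complexConj L) (Matrix.of fun i j : Fin 2 => if i.val + j.val + 1 = 2 then (1 : L) else 0) (IsCMField.complexConj_ne_one L) w hw)).symm (ΦU ((localNonsplitEquiv (IsCMField.complexConj L) (Matrix.of fun i j : Fin 2 => if i.val + j.val + 1 = 2 then (1 : L) else 0) (IsCMField.complexConj_ne_one L) w hw) g))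
      invFun := fun g => ((localNonsplitEquiv (IsCMField.complexConj L) (Matrix.of fun i j : Fin 2 => if i.val + j.val + 1 = 2 then (1 : L) else 0) (IsCMField.complexConj_ne_one L) w hw)).symm (ΦU.symm ((localNonsplitEquiv (IsCMField.complexConj L) (Matrix.of fun i j : Fin 2 => if i.val + j.val + 1 = 2 then (1 : L) else 0) (IsCMField.complexConj_ne_one L) w hw) g))
      left_inv := fun g => by simp only [ContinuousMulEquiv.apply_symm_apply, Equiv.symm_apply_apply]; exact ((localNonsplitEquiv (IsCMField.complexConj L) (Matrix.of fun i j : Fin 2 => if i.val + j.val + 1 = 2 then (1 : L) else 0) (IsCMField.complexConj_ne_one L) w hw)).symm_apply_apply g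
      right_inv := fun g => by simp only [ContinuousMulEquiv.apply_symm_apply, Equiv.apply_symm_apply]; exact ((localNonsplitEquiv (IsCMField.complexConj L) (Matrix.of fun i j : Fin 2 => if i.val + j.val + 1 = 2 then (1 : L) else 0) (IsCMField.complexConj_ne_one L) w hw)).symm_apply_apply g } with hΦ
  have hEΦ : ∀ g : ((cmDatum L 2 (Matrix.of fun i j : Fin 2 => if i.val + j.val + 1 = 2 then (1 : L) else 0)).Local v), (localNonsplitEquiv (IsCMField.complexConj L) (Matrix.of fun i j : Fin 2 => if i.val + j.val + 1 = 2 then (1 : L) else 0) (IsCMField.complexConj_ne_one L) w hw) (Φ g) = ΦU ((localNonsplitEquiv (IsCMField.complexConj L) (Matrix.of fun i j : Fin 2 => if i.val + j.val + 1 = 2 then (1 : L) else 0) (IsCMField.complexConj_ne_one L) w hw) g) := fun g => ((localNonsplitEquiv (IsCMField.complexConj L) (Matrix.of fun i j : Fin 2 => if i.val + j.val + 1 = 2 then (1 : L) else 0) (IsCMField.complexConj_ne_one L) w hw)).apply_symm_apply _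
  -- `E₂` on conjugates, at the `GL₂` level
  have hEconj : ∀ a b : ((cmDatum L 2 (Matrix.of fun i j : Fin 2 => if i.val + j.val + 1 = 2 then (1 : L) else 0)).Local v), (((localNonsplitEquiv (IsCMField.complexConj L) (Matrix.of fun i j : Fin 2 => if i.val + j.val + 1 = 2 then (1 : L) else 0) (IsCMField.complexConj_ne_one L) w hw) (a⁻¹ * b) : ↥(unitaryGroupOfForm (galAdicCompletionMap (L := L) (IsCMField.complexConj L) hw) (placeForm (Matrix.of fun i j : Fin 2 => if i.val + j.val + 1 = 2 then (1 : L) else 0) w.1))) : GL (Fin 2) (w.1.adicCompletion L)) = ((((localNonsplitEquiv (IsCMField.complexConj L) (Matrix.of fun i j : Fin 2 => if i.val + j.val + 1 = 2 then (1 : L) else 0) (IsCMField.complexConj_ne_one L) w hw) a : ↥(unitaryGroupOfForm (galAdicCompletionMap (L := L) (IsCMField.complexConj L) hw) (placeForm (Matrix.of fun i j : Fin 2 => if i.val + j.val + 1 = 2 then (1 : L) else 0) w.1))) : GL (Fin 2) (w.1.adicCompletion L)))⁻¹ * (((localNonsplitEquiv (IsCMField.complexConj L) (Matrix.of fun i j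 : Fin 2 => if i.val + j.val + 1 = 2 then (1 : L) else 0) (IsCMField.complexConj_ne_one L) w hw) b : ↥(unitaryGroupOfForm (galAdicCompletionMap (L := L) (IsCMField.complexConj L) hw) (placeForm (Matrix.of fun i j : Fin 2 => if i.val + j.val + 1 = 2 then (1 : L) else 0) w.1))) : GL (Fin 2) (w.1.adicCompletion L)) := by
    intro a b
    have h1 := map_mul ((localNonsplitEquiv (IsCMField.complexConj L) (Matrix.of fun i j : Fin 2 => if i.val + j.val + 1 = 2 then (1 : L) else 0) (IsCMField.complexConj_ne_one L) w hw)) a⁻¹ b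
    have h3 := map_inv ((localNonsplitEquiv (IsCMField.complexConj L) (Matrix.of fun i j : Fin 2 => if i.val + j.val + 1 = 2 then (1 : L) else 0) (IsCMField.complexConj_ne_one L) w hw)) a
    rw [h3] at h1
    have h4 := congrArg (fun z : ↥(unitaryGroupOfForm (galAdicCompletionMap (L := L) (IsCMField.complexConj L) hw) (placeForm (Matrix.of fun i j : Fin 2 => if i.val + j.val + 1 = 2 then (1 : L) else 0) w.1)) => (z : GL (Fin 2) (w.1.adicCompletion L))) h1
    simp only [Subgroup.coe_mul, Subgroup.coe_inv] at h4
    exact h4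
  have hEconj3 : ∀ x y : ((cmDatum L 2 (Matrix.of fun i j : Fin 2 => if i.val + j.val + 1 = 2 then (1 : L) else 0)).Local v), (((localNonsplitEquiv (IsCMField.complexConj L) (Matrix.of fun i j : Fin 2 => if i.val + j.val + 1 = 2 then (1 : L) else 0) (IsCMField.complexConj_ne_one L) w hw) (y⁻¹ * x * y) : ↥(unitaryGroupOfForm (galAdicCompletionMap (L := L) (IsCMField.complexConj L) hw) (placeForm (Matrix.of fun i j : Fin 2 => if i.val + j.val + 1 = 2 then (1 : L) else 0) w.1))) : GL (Fin 2) (w.1.adicCompletion L)) =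
      ((((localNonsplitEquiv (IsCMField.complexConj L) (Matrix.of fun i j : Fin 2 => if i.val + j.val + 1 = 2 then (1 : L) else 0) (IsCMField.complexConj_ne_one L) w hw) y : ↥(unitaryGroupOfForm (galAdicCompletionMap (L := L) (IsCMField.complexConj L) hw) (placeForm (Matrix.of fun i j : Fin 2 => if i.val + j.val + 1 = 2 then (1 : L) else 0) w.1))) : GL (Fin 2) (w.1.adicCompletion L)))⁻¹ * (((localNonsplitEquiv (IsCMField.complexConj L) (Matrix.of fun i j : Fin 2 => if i.val + j.val + 1 = 2 then (1 : L) else 0) (IsCMField.complexConj_ne_one L) w hw) x : ↥(unitaryGroupOfForm (galAdicCompletionMap (L := L) (IsCMField.complexConj L) hw) (placeForm (Matrix.of fun i j : Fin 2 => if i.val + j.val + 1 = 2 then (1 : L) else 0) w.1))) : GL (Fin 2) (w.1.adicCompletion L)) * (((localNonsplitEquiv (IsCMField.complexConj L) (Matrix.of fun i j : Fin 2 => if i.val + j.val + 1 = 2 then (1 : L) else 0) (IsCMField.complexConj_ne_one L) w hw) y : ↥(unitaryGroupOfForm (galAdicCompletionMap (L := L) (IsCMField.complexConj L) hw) (placeForm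 (Matrix.of fun i j : Fin 2 => if i.val + j.val + 1 = 2 then (1 : L) else 0) w.1))) : GL (Fin 2) (w.1.adicCompletion L)) := by
    intro x y
    have h1 := map_mul ((localNonsplitEquiv (IsCMField.complexConj L) (Matrix.of fun i j : Fin 2 => if i.val + j.val + 1 = 2 then (1 : L) else 0) (IsCMField.complexConj_ne_one L) w hw)) (y⁻¹ * x) y
    have h2 := map_mul ((localNonsplitEquiv (IsCMField.complexConj L) (Matrix.of fun i j : Fin 2 => if i.val + j.val + 1 = 2 then (1 : L) else 0) (IsCMField.complexConj_ne_one L) w hw)) y⁻¹ x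
    have h3 := map_inv ((localNonsplitEquiv (IsCMField.complexConj L) (Matrix.of fun i j : Fin 2 => if i.val + j.val + 1 = 2 then (1 : L) else 0) (IsCMField.complexConj_ne_one L) w hw)) y
    rw [h2, h3] at h1
    have h4 := congrArg (fun z : ↥(unitaryGroupOfForm (galAdicCompletionMap (L := L) (IsCMField.complexConj L) hw) (placeForm (Matrix.of fun i j : Fin 2 => if i.val + j.val + 1 = 2 then (1 : L) else 0) w.1)) => (z : GL (Fin 2) (w.1.adicCompletion L))) h1
    simp only [Subgroup.coe_mul, Subgroup.coe_inv] at h4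
    exact h4
  -- `P := k₀⁻¹ X₀ ∈ GL₂(𝒪_w)`: an INTEGRAL similitude of multiplier `ι(ν)`
  have hPsim : ((((k₀⁻¹ * X₀ : GL (Fin 2) (w.1.adicCompletion L))) : Matrix (Fin 2) (Fin 2) (w.1.adicCompletion L)).map (galAdicCompletionMap (L := L) (IsCMField.complexConj L) hw))ᵀ * !![(0 : (w.1.adicCompletion L)), 1; 1, 0] * ((k₀⁻¹ * X₀ : GL (Fin 2) (w.1.adicCompletion L)) : Matrix (Fin 2) (Fin 2) (w.1.adicCompletion L)) =
      toPlace v w ν • !![(0 : (w.1.adicCompletion L)), 1; 1, 0] := by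
    have hk := mem_unitaryGroupOfForm_iff.1 (inv_mem hk₀J)
    rw [Units.val_mul, Matrix.map_mul, Matrix.transpose_mul]
    calc ((X₀ : Matrix (Fin 2) (Fin 2) (w.1.adicCompletion L)).map (galAdicCompletionMap (L := L) (IsCMField.complexConj L) hw))ᵀ * (((k₀⁻¹ : GL (Fin 2) (w.1.adicCompletion L)) : Matrix (Fin 2) (Fin 2) (w.1.adicCompletion L)).map (galAdicCompletionMap (L := L) (IsCMField.complexConj L) hw))ᵀ * !![(0 : (w.1.adicCompletion L)), 1; 1, 0] *
          (((k₀⁻¹ : GL (Fin 2) (w.1.adicCompletion L)) : Matrix (Fin 2) (Fin 2) (w.1.adicCompletion L)) * (X₀ : Matrix (Fin 2) (Fin 2) (w.1.adicCompletion L)))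
        = ((X₀ : Matrix (Fin 2) (Fin 2) (w.1.adicCompletion L)).map (galAdicCompletionMap (L := L) (IsCMField.complexConj L) hw))ᵀ * ((((k₀⁻¹ : GL (Fin 2) (w.1.adicCompletion L)) : Matrix (Fin 2) (Fin 2) (w.1.adicCompletion L)).map (galAdicCompletionMap (L := L) (IsCMField.complexConj L) hw))ᵀ * !![(0 : (w.1.adicCompletion L)), 1; 1, 0] *
            ((k₀⁻¹ : GL (Fin 2) (w.1.adicCompletion L)) : Matrix (Fin 2) (Fin 2) (w.1.adicCompletion L))) * (X₀ : Matrix (Fin 2) (Fin 2) (w.1.adicCompletion L)) := by simp only [Matrix.mul_assoc]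
      _ = _ := by rw [hk, hsim]
  have hPP' : ((k₀⁻¹ * X₀ : GL (Fin 2) (w.1.adicCompletion L)) : Matrix (Fin 2) (Fin 2) (w.1.adicCompletion L)) * (((k₀⁻¹ * X₀)⁻¹ : GL (Fin 2) (w.1.adicCompletion L)) : Matrix (Fin 2) (Fin 2) (w.1.adicCompletion L)) = 1 := by
    rw [← Units.val_mul, mul_inv_cancel, Units.val_one]
  have hP'P : (((k₀⁻¹ * X₀)⁻¹ : GL (Fin 2) (w.1.adicCompletion L)) : Matrix (Fin 2) (Fin 2) (w.1.adicCompletion L)) * ((k₀⁻¹ * X₀ : GL (Fin 2) (w.1.adicCompletion L)) : Matrix (Fin 2) (Fin 2) (w.1.adicCompletion L)) = 1 := by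
    rw [← Units.val_mul, inv_mul_cancel, Units.val_one]
  have hPi := ((mem_glInt_iff_forall_v_le_one_and_v_det_eq_one (k₀⁻¹ * X₀)).1 hPint).1
  have hP'i := ((mem_glInt_iff_forall_v_le_one_and_v_det_eq_one ((k₀⁻¹ * X₀)⁻¹)).1 (inv_mem hPint)).1
  have hcν : Valued.v (c₀ - toPlace v w ν * c₁) < 1 := by
    rw [show c₀ - toPlace v w ν * c₁ = -(c₁ * (toPlace v w ν - c₀ * c₁⁻¹)) by field_simp; ring, Valuation.map_neg, map_mul, hc₁, one_mul]
    exact hνc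
  -- `K⁰`-membership through `E₂`
  have hK0 : ∀ y : ((cmDatum L 2 (Matrix.of fun i j : Fin 2 => if i.val + j.val + 1 = 2 then (1 : L) else 0)).Local v), y ∈ (cmLocalIntegralLevel L 2 (Matrix.of fun i j : Fin 2 => if i.val + j.val + 1 = 2 then (1 : L) else 0) v) ↔ (((localNonsplitEquiv (IsCMField.complexConj L) (Matrix.of fun i j : Fin 2 => if i.val + j.val + 1 = 2 then (1 : L) else 0) (IsCMField.complexConj_ne_one L) w hw) y : ↥(unitaryGroupOfForm (galAdicCompletionMap (L := L) (IsCMField.complexConj L) hw) (placeForm (Matrix.of fun i j : Fin 2 => if i.val + j.val + 1 = 2 then (1 : L) else 0) w.1))) : GL (Fin 2) (w.1.adicCompletion L)) ∈ glInt 2 (w.1.adicCompletion L) :=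
    fun y => mem_localIntegralLevel_iff_of_smul_eq (IsCMField.complexConj L) 2 (Matrix.of fun i j : Fin 2 => if i.val + j.val + 1 = 2 then (1 : L) else 0) (IsCMField.complexConj_ne_one L) w hw y
  -- coset compatibility in both directions: `E₂((Φg₁)⁻¹ Φg₂) = P · E₂(g₁⁻¹g₂) · P⁻¹`
  have hΦK : ∀ g₁ g₂ : ((cmDatum L 2 (Matrix.of fun i j : Fin 2 => if i.val + j.val + 1 = 2 then (1 : L) else 0)).Local v), g₁⁻¹ * g₂ ∈ (cmLocalIntegralLevel L 2 (Matrix.of fun i j : Fin 2 => if i.val + j.val + 1 = 2 then (1 : L) else 0) v) ↔ (Φ g₁)⁻¹ * Φ g₂ ∈ (cmLocalIntegralLevel L 2 (Matrix.of fun i j : Fin 2 => if i.val + j.val + 1 = 2 then (1 : L) else 0) v) := by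
    intro g₁ g₂
    rw [hK0, hK0, hEconj, hEconj, hEΦ, hEΦ, hΦU_apply, hΦU_apply]
    rw [show (X₀ * (((localNonsplitEquiv (IsCMField.complexConj L) (Matrix.of fun i j : Fin 2 => if i.val + j.val + 1 = 2 then (1 : L) else 0) (IsCMField.complexConj_ne_one L) w hw) g₁ : ↥(unitaryGroupOfForm (galAdicCompletionMap (L := L) (IsCMField.complexConj L) hw) (placeForm (Matrix.of fun i j : Fin 2 => if i.val + j.val + 1 = 2 then (1 : L) else 0) w.1))) : GL (Fin 2) (w.1.adicCompletion L)) * X₀⁻¹ * k₀)⁻¹ * (X₀ * (((localNonsplitEquiv (IsCMField.complexConj L) (Matrix.of fun i j : Fin 2 => if i.val + j.val + 1 = 2 then (1 : L) else 0) (IsCMField.complexConj_ne_one L) w hw) g₂ : ↥(unitaryGroupOfForm (galAdicCompletionMap (L := L) (IsCMField.complexConj L) hw) (placeForm (Matrix.of fun i j : Fin 2 => if i.val + j.val + 1 = 2 then (1 : L) else 0) w.1))) : GL (Fin 2) (w.1.adicCompletion L)) * X₀⁻¹ * k₀) =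
        (k₀⁻¹ * X₀) * (((((localNonsplitEquiv (IsCMField.complexConj L) (Matrix.of fun i j : Fin 2 => if i.val + j.val + 1 = 2 then (1 : L) else 0) (IsCMField.complexConj_ne_one L) w hw) g₁ : ↥(unitaryGroupOfForm (galAdicCompletionMap (L := L) (IsCMField.complexConj L) hw) (placeForm (Matrix.of fun i j : Fin 2 => if i.val + j.val + 1 = 2 then (1 : L) else 0) w.1))) : GL (Fin 2) (w.1.adicCompletion L)))⁻¹ * (((localNonsplitEquiv (IsCMField.complexConj L) (Matrix.of fun i j : Fin 2 => if i.val + j.val + 1 = 2 then (1 : L) else 0) (IsCMField.complexConj_ne_one L) w hw) g₂ : ↥(unitaryGroupOfForm (galAdicCompletionMap (L := L) (IsCMField.complexConj L) hw) (placeForm (Matrix.of fun i j : Fin 2 => if i.val + j.val + 1 = 2 then (1 : L) else 0) w.1))) : GL (Fin 2) (w.1.adicCompletion L))) * (k₀⁻¹ * X₀)⁻¹ by group,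
      Subgroup.mul_mem_cancel_right _ (inv_mem hPint), Subgroup.mul_mem_cancel_left _ hPint]
  -- the monodromy at `Φ g` is the `P`-conjugate of the monodromy at `g`
  have hmono : ∀ g' : ((cmDatum L 2 (Matrix.of fun i j : Fin 2 => if i.val + j.val + 1 = 2 then (1 : L) else 0)).Local v), ((((localNonsplitEquiv (IsCMField.complexConj L) (Matrix.of fun i j : Fin 2 => if i.val + j.val + 1 = 2 then (1 : L) else 0) (IsCMField.complexConj_ne_one L) w hw) ((Φ g')⁻¹ * γ₂ * Φ g') : ↥(unitaryGroupOfForm (galAdicCompletionMap (L := L) (IsCMField.complexConj L) hw) (placeForm (Matrix.of fun i j : Fin 2 => if i.val + j.val + 1 = 2 then (1 : L) else 0) w.1))) : GL (Fin 2) (w.1.adicCompletion L)) : Matrix (Fin 2) (Fin 2) (w.1.adicCompletion L)) =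
      ((k₀⁻¹ * X₀ : GL (Fin 2) (w.1.adicCompletion L)) : Matrix (Fin 2) (Fin 2) (w.1.adicCompletion L)) * ((((localNonsplitEquiv (IsCMField.complexConj L) (Matrix.of fun i j : Fin 2 => if i.val + j.val + 1 = 2 then (1 : L) else 0) (IsCMField.complexConj_ne_one L) w hw) (g'⁻¹ * γ₂ * g') : ↥(unitaryGroupOfForm (galAdicCompletionMap (L := L) (IsCMField.complexConj L) hw) (placeForm (Matrix.of fun i j : Fin 2 => if i.val + j.val + 1 = 2 then (1 : L) else 0) w.1))) : GL (Fin 2) (w.1.adicCompletion L)) : Matrix (Fin 2) (Fin 2) (w.1.adicCompletion L)) * (((k₀⁻¹ * X₀)⁻¹ : GL (Fin 2) (w.1.adicCompletion L)) : Matrix (Fin 2) (Fin 2) (w.1.adicCompletion L)) := by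
    intro g'
    have h1 : (((localNonsplitEquiv (IsCMField.complexConj L) (Matrix.of fun i j : Fin 2 => if i.val + j.val + 1 = 2 then (1 : L) else 0) (IsCMField.complexConj_ne_one L) w hw) ((Φ g')⁻¹ * γ₂ * Φ g') : ↥(unitaryGroupOfForm (galAdicCompletionMap (L := L) (IsCMField.complexConj L) hw) (placeForm (Matrix.of fun i j : Fin 2 => if i.val + j.val + 1 = 2 then (1 : L) else 0) w.1))) : GL (Fin 2) (w.1.adicCompletion L)) =
        (k₀⁻¹ * X₀) * (((localNonsplitEquiv (IsCMField.complexConj L) (Matrix.of fun i j : Fin 2 => if i.val + j.val + 1 = 2 then (1 : L) else 0) (IsCMField.complexConj_ne_one L) w hw) (g'⁻¹ * γ₂ * g') : ↥(unitaryGroupOfForm (galAdicCompletionMap (L := L) (IsCMField.complexConj L) hw) (placeForm (Matrix.of fun i j : Fin 2 => if i.val + j.val + 1 = 2 then (1 : L) else 0) w.1))) : GL (Fin 2) (w.1.adicCompletion L)) * (k₀⁻¹ * X₀)⁻¹ := by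
      rw [hEconj3, hEconj3, hEΦ, hΦU_apply]
      calc (X₀ * (((localNonsplitEquiv (IsCMField.complexConj L) (Matrix.of fun i j : Fin 2 => if i.val + j.val + 1 = 2 then (1 : L) else 0) (IsCMField.complexConj_ne_one L) w hw) g' : ↥(unitaryGroupOfForm (galAdicCompletionMap (L := L) (IsCMField.complexConj L) hw) (placeForm (Matrix.of fun i j : Fin 2 => if i.val + j.val + 1 = 2 then (1 : L) else 0) w.1))) : GL (Fin 2) (w.1.adicCompletion L)) * X₀⁻¹ * k₀)⁻¹ * (((localNonsplitEquiv (IsCMField.complexConj L) (Matrix.of fun i j : Fin 2 => if i.val + j.val + 1 = 2 then (1 : L) else 0) (IsCMField.complexConj_ne_one L) w hw) γ₂ : ↥(unitaryGroupOfForm (galAdicCompletionMap (L := L) (IsCMField.complexConj L) hw) (placeForm (Matrix.of fun i j : Fin 2 => if i.val + j.val + 1 = 2 then (1 : L) else 0) w.1))) : GL (Fin 2) (w.1.adicCompletion L)) * (X₀ * (((localNonsplitEquiv (IsCMField.complexConj L) (Matrix.of fun i j : Fin 2 => if i.val + j.val + 1 = 2 then (1 : L) else 0) (IsCMField.complexConj_ne_one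 L) w hw) g' : ↥(unitaryGroupOfForm (galAdicCompletionMap (L := L) (IsCMField.complexConj L) hw) (placeForm (Matrix.of fun i j : Fin 2 => if i.val + j.val + 1 = 2 then (1 : L) else 0) w.1))) : GL (Fin 2) (w.1.adicCompletion L)) * X₀⁻¹ * k₀)
          = (k₀⁻¹ * X₀) * (((((localNonsplitEquiv (IsCMField.complexConj L) (Matrix.of fun i j : Fin 2 => if i.val + j.val + 1 = 2 then (1 : L) else 0) (IsCMField.complexConj_ne_one L) w hw) g' : ↥(unitaryGroupOfForm (galAdicCompletionMap (L := L) (IsCMField.complexConj L) hw) (placeForm (Matrix.of fun i j : Fin 2 => if i.val + j.val + 1 = 2 then (1 : L) else 0) w.1))) : GL (Fin 2) (w.1.adicCompletion L)))⁻¹ * (X₀⁻¹ * (((localNonsplitEquiv (IsCMField.complexConj L) (Matrix.of fun i j : Fin 2 => if i.val + j.val + 1 = 2 then (1 : L) else 0) (IsCMField.complexConj_ne_one L) w hw) γ₂ : ↥(unitaryGroupOfForm (galAdicCompletionMap (L := L) (IsCMField.complexConj L) hw) (placeForm (Matrix.of fun i j : Fin 2 => if i.val + j.val + 1 = 2 then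 (1 : L) else 0) w.1))) : GL (Fin 2) (w.1.adicCompletion L)) * X₀) * (((localNonsplitEquiv (IsCMField.complexConj L) (Matrix.of fun i j : Fin 2 => if i.val + j.val + 1 = 2 then (1 : L) else 0) (IsCMField.complexConj_ne_one L) w hw) g' : ↥(unitaryGroupOfForm (galAdicCompletionMap (L := L) (IsCMField.complexConj L) hw) (placeForm (Matrix.of fun i j : Fin 2 => if i.val + j.val + 1 = 2 then (1 : L) else 0) w.1))) : GL (Fin 2) (w.1.adicCompletion L))) * (k₀⁻¹ * X₀)⁻¹ := by group
        _ = _ := by rw [hconjX]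
    have h2 := congrArg (fun z : GL (Fin 2) (w.1.adicCompletion L) => (z : Matrix (Fin 2) (Fin 2) (w.1.adicCompletion L))) h1
    simp only [Units.val_mul] at h2
    exact h2
  -- stability of `S` in both directions
  have hSiff : ∀ Y : Matrix (Fin 2) (Fin 2) (w.1.adicCompletion L), S (((k₀⁻¹ * X₀ : GL (Fin 2) (w.1.adicCompletion L)) : Matrix (Fin 2) (Fin 2) (w.1.adicCompletion L)) * Y * (((k₀⁻¹ * X₀)⁻¹ : GL (Fin 2) (w.1.adicCompletion L)) : Matrix (Fin 2) (Fin 2) (w.1.adicCompletion L))) ↔ S Y := by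
    intro Y
    refine ⟨fun h => ?_, hS _ hPint Y⟩
    have h' := hS _ (inv_mem hPint) _ h
    have e : (((k₀⁻¹ * X₀)⁻¹ : GL (Fin 2) (w.1.adicCompletion L)) : Matrix (Fin 2) (Fin 2) (w.1.adicCompletion L)) * ((((k₀⁻¹ * X₀ : GL (Fin 2) (w.1.adicCompletion L)) : Matrix (Fin 2) (Fin 2) (w.1.adicCompletion L)) * Y * (((k₀⁻¹ * X₀)⁻¹ : GL (Fin 2) (w.1.adicCompletion L)) : Matrix (Fin 2) (Fin 2) (w.1.adicCompletion L)))) *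
        ((((k₀⁻¹ * X₀)⁻¹)⁻¹ : GL (Fin 2) (w.1.adicCompletion L)) : Matrix (Fin 2) (Fin 2) (w.1.adicCompletion L)) = Y := by
      rw [inv_inv]
      calc (((k₀⁻¹ * X₀)⁻¹ : GL (Fin 2) (w.1.adicCompletion L)) : Matrix (Fin 2) (Fin 2) (w.1.adicCompletion L)) * ((((k₀⁻¹ * X₀ : GL (Fin 2) (w.1.adicCompletion L)) : Matrix (Fin 2) (Fin 2) (w.1.adicCompletion L)) * Y * (((k₀⁻¹ * X₀)⁻¹ : GL (Fin 2) (w.1.adicCompletion L)) : Matrix (Fin 2) (Fin 2) (w.1.adicCompletion L)))) * ((k₀⁻¹ * X₀ : GL (Fin 2) (w.1.adicCompletion L)) : Matrix (Fin 2) (Fin 2) (w.1.adicCompletion L))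
          = ((((k₀⁻¹ * X₀)⁻¹ : GL (Fin 2) (w.1.adicCompletion L)) : Matrix (Fin 2) (Fin 2) (w.1.adicCompletion L)) * ((k₀⁻¹ * X₀ : GL (Fin 2) (w.1.adicCompletion L)) : Matrix (Fin 2) (Fin 2) (w.1.adicCompletion L))) * Y *
              ((((k₀⁻¹ * X₀)⁻¹ : GL (Fin 2) (w.1.adicCompletion L)) : Matrix (Fin 2) (Fin 2) (w.1.adicCompletion L)) * ((k₀⁻¹ * X₀ : GL (Fin 2) (w.1.adicCompletion L)) : Matrix (Fin 2) (Fin 2) (w.1.adicCompletion L))) := by simp only [Matrix.mul_assoc]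
        _ = Y := by rw [hP'P, Matrix.one_mul, Matrix.mul_one]
    rwa [e] at h'
  -- assemble: transport of coset counts along `Φ`
  refine (natCard_setOf_exists_mk_eq_of_equiv ((cmLocalIntegralLevel L 2 (Matrix.of fun i j : Fin 2 => if i.val + j.val + 1 = 2 then (1 : L) else 0) v)) Φ hΦK
    (fun h : ((cmDatum L 2 (Matrix.of fun i j : Fin 2 => if i.val + j.val + 1 = 2 then (1 : L) else 0)).Local v) => S (((((localNonsplitEquiv (IsCMField.complexConj L) (Matrix.of fun i j : Fin 2 => if i.val + j.val + 1 = 2 then (1 : L) else 0) (IsCMField.complexConj_ne_one L) w hw) (h⁻¹ * γ₂ * h) : ↥(unitaryGroupOfForm (galAdicCompletionMap (L := L) (IsCMField.complexConj L) hw) (placeForm (Matrix.of fun i j : Fin 2 => if i.val + j.val + 1 = 2 then (1 : L) else 0) w.1))) : GL (Fin 2) (w.1.adicCompletion L)) : Matrix (Fin 2) (Fin 2) (w.1.adicCompletion L))) ∧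
      ∃ (y : Fin 2 → (w.1.adicCompletion L)) (a : (w.1.adicCompletion L)), (∀ i, Valued.v (y i) ≤ 1) ∧ Valued.v a = 1 ∧
        Valued.v (ϖ₁ * ((fun i => (galAdicCompletionMap (L := L) (IsCMField.complexConj L) hw) (y i)) ⬝ᵥ (!![(0 : (w.1.adicCompletion L)), 1; 1, 0] *ᵥ ((((((localNonsplitEquiv (IsCMField.complexConj L) (Matrix.of fun i j : Fin 2 => if i.val + j.val + 1 = 2 then (1 : L) else 0) (IsCMField.complexConj_ne_one L) w hw) (h⁻¹ * γ₂ * h) : ↥(unitaryGroupOfForm (galAdicCompletionMap (L := L) (IsCMField.complexConj L) hw) (placeForm (Matrix.of fun i j : Fin 2 => if i.val + j.val + 1 = 2 then (1 : L) else 0) w.1))) : GL (Fin 2) (w.1.adicCompletion L)) : Matrix (Fin 2) (Fin 2) (w.1.adicCompletion L)) - ((((((localNonsplitEquiv (IsCMField.complexConj L) (Matrix.of fun i j : Fin 2 => if i.val + j.val + 1 = 2 then (1 : L) else 0) (IsCMField.complexConj_ne_one L) w hw) (γ₂) : ↥(unitaryGroupOfForm (galAdicCompletionMap (L := L) (IsCMField.complexConj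 L) hw) (placeForm (Matrix.of fun i j : Fin 2 => if i.val + j.val + 1 = 2 then (1 : L) else 0) w.1))) : GL (Fin 2) (w.1.adicCompletion L)) : Matrix (Fin 2) (Fin 2) (w.1.adicCompletion L))).trace / 2) • (1 : Matrix (Fin 2) (Fin 2) (w.1.adicCompletion L))) *ᵥ y))) - c₁ * a ^ 2) < 1)
    (fun h : ((cmDatum L 2 (Matrix.of fun i j : Fin 2 => if i.val + j.val + 1 = 2 then (1 : L) else 0)).Local v) => S (((((localNonsplitEquiv (IsCMField.complexConj L) (Matrix.of fun i j : Fin 2 => if i.val + j.val + 1 = 2 then (1 : L) else 0) (IsCMField.complexConj_ne_one L) w hw) (h⁻¹ * γ₂ * h) : ↥(unitaryGroupOfForm (galAdicCompletionMap (L := L) (IsCMField.complexConj L) hw) (placeForm (Matrix.of fun i j : Fin 2 => if i.val + j.val + 1 = 2 then (1 : L) else 0) w.1))) : GL (Fin 2) (w.1.adicCompletion L)) : Matrix (Fin 2) (Fin 2) (w.1.adicCompletion L))) ∧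
      ∃ (y : Fin 2 → (w.1.adicCompletion L)) (a : (w.1.adicCompletion L)), (∀ i, Valued.v (y i) ≤ 1) ∧ Valued.v a = 1 ∧
        Valued.v (ϖ₁ * ((fun i => (galAdicCompletionMap (L := L) (IsCMField.complexConj L) hw) (y i)) ⬝ᵥ (!![(0 : (w.1.adicCompletion L)), 1; 1, 0] *ᵥ ((((((localNonsplitEquiv (IsCMField.complexConj L) (Matrix.of fun i j : Fin 2 => if i.val + j.val + 1 = 2 then (1 : L) else 0) (IsCMField.complexConj_ne_one L) w hw) (h⁻¹ * γ₂ * h) : ↥(unitaryGroupOfForm (galAdicCompletionMap (L := L) (IsCMField.complexConj L) hw) (placeForm (Matrix.of fun i j : Fin 2 => if i.val + j.val + 1 = 2 then (1 : L) else 0) w.1))) : GL (Fin 2) (w.1.adicCompletion L)) : Matrix (Fin 2) (Fin 2) (w.1.adicCompletion L)) - ((((((localNonsplitEquiv (IsCMField.complexConj L) (Matrix.of fun i j : Fin 2 => if i.val + j.val + 1 = 2 then (1 : L) else 0) (IsCMField.complexConj_ne_one L) w hw) (γ₂) : ↥(unitaryGroupOfForm (galAdicCompletionMap (L := L) (IsCMField.complexConj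 L) hw) (placeForm (Matrix.of fun i j : Fin 2 => if i.val + j.val + 1 = 2 then (1 : L) else 0) w.1))) : GL (Fin 2) (w.1.adicCompletion L)) : Matrix (Fin 2) (Fin 2) (w.1.adicCompletion L))).trace / 2) • (1 : Matrix (Fin 2) (Fin 2) (w.1.adicCompletion L))) *ᵥ y))) - c₀ * a ^ 2) < 1)
    fun g' => ?_).symm
  simp only [hmono g']
  exact and_congr (hSiff _) (exists_class_conj_iff w.1 (galAdicCompletionMap (L := L) (IsCMField.complexConj L) hw) hPsim hιν hPP' hP'P hPi hP'i hcν ϖ₁ _ _)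

end ClassLaw

end Literature.NumberTheory.Automorphic.UnitaryGroup

end
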